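import Mathlib
import Summits.ValiantsHypothesis.ValiantsHypothesis.Theorems.LacunarySymmetroidMatrixDescartesDefiniteMomentsOneCrossing
import Summits.ValiantsHypothesis.ValiantsHypothesis.Theorems.LacunarySymmetroidMatrixDescartesCensusFatSectors

/-!
# `MatrixDescartes` (stmt-ValiantsHypothesis-18050) — the INTRINSIC ONE-CROSSING SECTOR in the crux's currency: lowest
# letter definite of either sign, both half-lines, `Z ≤ 2m + 1`, and the crux inequality at every fat format

HONEST FRAMING.  Cell `pub-symmetroid`, seat `val-sym-mdr-p2` (gen 16); helper LEAF file `--supports` the crux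
`Theses.LacunarySymmetroid.MatrixDescartes`, NO closure claim.  Like gen 14's `…DefiniteMomentsMDR` and gen 15's `…ZonesMDR`
it imports the census cone's `Census.fatFormat_absorb` (theses-cone warning: leaf file, nothing imports it).  A new FORMAT-FREE
family on which the crux inequality `Z^q ≤ 2^{K⌊log₂K⌋}` is PROVED at every admissible size, fat formats included; nothing
here bears on the crux in its window, on `stub_twoSided`, on `DoorA26`/`DoorA34`, registers, or `VP ≠ VNP`.

CONTENT.  (§1) `card_posRoots_le_of_oneCrossing_negDef` — the one-crossing law with `S₀ ≺ 0` (apply the `S₀ ≻ 0` law to the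
letters `−Sₗ`: same determinant roots, same Rayleigh roots).  (§2) `oneCrossing_realRoots_le` — if `F(X)` and its reflection
`F(−X) = ∑ X^{dₗ}((−1)^{dₗ}Sₗ)` both have a definite lowest letter and one-crossing Rayleigh `K`-nomials, then `det F` has at
most `m + m + 1` distinct real zeros.  (§3) `oneCrossing_mdr` — hence `Z^q ≤ 2^{K⌊log₂K⌋}` for all large `K` and all
`m ≤ 2^{(⌊log₂K⌋+c)^c}`. [folklore]; axioms standard; no definitions.
-/

-- layout Summits/ValiantsHypothesis/ValiantsHypothesis forces the duplicated namespace component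
set_option linter.dupNamespace false

namespace Summit.ValiantsHypothesis.ValiantsHypothesis.Theorems.LacunarySymmetroidMatrixDescartes

open Polynomial Matrix Finset
open scoped BigOperators Topology

namespace DefiniteMoments

variable {ι : Type} [Fintype ι] [DecidableEq ι]

/-! ## §1 Lowest letter negative definite -/

omit [DecidableEq ι] in
/-- The Rayleigh `K`-nomial of the negated letters is the negative. [folklore] -/
theorem rayleighPoly_neg {K : ℕ} (d : Fin K → ℕ) (S : Fin K → Matrix ι ι ℝ) (v : ι → ℝ) :
    (∑ l, C (v ⬝ᵥ ((-S l) *ᵥ v)) * (X : ℝ[X]) ^ d l) = -∑ l, C (v ⬝ᵥ (S l *ᵥ v)) * (X : ℝ[X]) ^ d l := by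
  rw [← Finset.sum_neg_distrib]
  refine Finset.sum_congr rfl fun l _ => ?_
  rw [Matrix.neg_mulVec, dotProduct_neg, C_neg, neg_mul]

/-- The determinant of the negated pencil has the same roots. [folklore] -/
theorem roots_det_pencil_neg {K : ℕ} (d : Fin K → ℕ) (S : Fin K → Matrix ι ι ℝ) :
    (Matrix.det (∑ k, ((X : ℝ[X]) ^ d k) • (-S k).map C)).roots
      = (Matrix.det (∑ k, ((X : ℝ[X]) ^ d k) • (S k).map C)).roots := by
  have h : (∑ k, ((X : ℝ[X]) ^ d k) • (-S k).map C) = -∑ k, ((X : ℝ[X]) ^ d k) • (S k).map C := by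
    rw [← Finset.sum_neg_distrib]
    refine Finset.sum_congr rfl fun k _ => ?_
    ext i j
    simp [Matrix.map_apply, Matrix.smul_apply]
  rw [h, Matrix.det_neg, ← C_1, ← C_neg, ← C_pow, roots_C_mul]
  exact pow_ne_zero _ (by norm_num)

/-- **One-crossing law, lowest letter NEGATIVE definite.** [folklore] -/
theorem card_posRoots_le_of_oneCrossing_negDef {K : ℕ} (hK : 2 ≤ K) (d : Fin K → ℕ) (hd : StrictMono d)
    (S : Fin K → Matrix ι ι ℝ) (hS : ∀ l, (S l).IsSymm)
    (h0 : ∀ v : ι → ℝ, v ≠ 0 → v ⬝ᵥ (S ⟨0, by omega⟩ *ᵥ v) < 0)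
    (hone : ∀ v : ι → ℝ, v ≠ 0 →
      Multiset.card ((∑ l, C (v ⬝ᵥ (S l *ᵥ v)) * (X : ℝ[X]) ^ d l).roots.filter (fun t => 0 < t)) ≤ 1) :
    ((Matrix.det (∑ k, ((X : ℝ[X]) ^ d k) • (S k).map C)).roots.toFinset.filter (fun t => 0 < t)).card
      ≤ Fintype.card ι := by
  have h := card_posRoots_le_of_oneCrossing hK d hd (fun l => -S l) (fun l => (hS l).neg)
    (fun v hv => by rw [Matrix.neg_mulVec, dotProduct_neg, neg_pos]; exact h0 v hv)
    (fun v hv => by rw [rayleighPoly_neg, roots_neg]; exact hone v hv)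
  rw [roots_det_pencil_neg] at h
  exact h

/-- **One-crossing law, lowest letter definite of either sign (`σ = ±1`).** [folklore] -/
theorem card_posRoots_le_of_oneCrossing_definite {K : ℕ} (hK : 2 ≤ K) (d : Fin K → ℕ) (hd : StrictMono d)
    (S : Fin K → Matrix ι ι ℝ) (hS : ∀ l, (S l).IsSymm) (σ : ℝ)
    (h0 : ∀ v : ι → ℝ, v ≠ 0 → 0 < σ * (v ⬝ᵥ (S ⟨0, by omega⟩ *ᵥ v)))
    (hone : ∀ v : ι → ℝ, v ≠ 0 →
      Multiset.card ((∑ l, C (v ⬝ᵥ (S l *ᵥ v)) * (X : ℝ[X]) ^ d l).roots.filter (fun t => 0 < t)) ≤ 1) :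
    ((Matrix.det (∑ k, ((X : ℝ[X]) ^ d k) • (S k).map C)).roots.toFinset.filter (fun t => 0 < t)).card
      ≤ Fintype.card ι := by
  classical
  rcases isEmpty_or_nonempty ι with hι | hι
  · rw [Fintype.card_eq_zero]
    have : Matrix.det (∑ k, ((X : ℝ[X]) ^ d k) • (S k).map C) = 1 := Matrix.det_isEmpty
    rw [this, roots_one]
    simp
  have hv₀ : (fun _ : ι => (1 : ℝ)) ≠ 0 := fun h => by
    have := congrFun h (Classical.arbitrary ι); simp at this
  have hσ0 : σ ≠ 0 := by
    intro h; have := h0 _ hv₀; rw [h, zero_mul] at this; exact lt_irrefl 0 this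
  rcases lt_or_gt_of_ne hσ0 with hσ | hσ
  · exact card_posRoots_le_of_oneCrossing_negDef hK d hd S hS (fun v hv => neg_of_mul_pos_left' hσ (h0 v hv)) hone
  · exact card_posRoots_le_of_oneCrossing hK d hd S hS (fun v hv => pos_of_mul_pos_left' hσ (h0 v hv)) hone

/-! ## §2 Both half-lines -/

/-- **Real zeros on the two-sided one-crossing sector.**  `K ≥ 2` real symmetric `m × m` letters at strictly increasing
exponents; if `F(X)` and its reflection `F(−X)` both have a definite lowest letter and one-crossing Rayleigh `K`-nomials, then
`det F` has at most `m + m + 1` distinct real zeros. [folklore] -/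
theorem oneCrossing_realRoots_le (K m : ℕ) (hK : 2 ≤ K) (d : Fin K → ℕ) (hd : StrictMono d)
    (S : Fin K → Matrix (Fin m) (Fin m) ℝ) (hS : ∀ l, (S l).IsSymm) (σ σ' : ℝ)
    (h0 : ∀ v : Fin m → ℝ, v ≠ 0 → 0 < σ * (v ⬝ᵥ (S ⟨0, by omega⟩ *ᵥ v)))
    (hone : ∀ v : Fin m → ℝ, v ≠ 0 →
      Multiset.card ((∑ l, C (v ⬝ᵥ (S l *ᵥ v)) * (X : ℝ[X]) ^ d l).roots.filter (fun t => 0 < t)) ≤ 1)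
    (h0' : ∀ v : Fin m → ℝ, v ≠ 0 → 0 < σ' * (v ⬝ᵥ ((((-1 : ℝ) ^ d ⟨0, by omega⟩) • S ⟨0, by omega⟩) *ᵥ v)))
    (hone' : ∀ v : Fin m → ℝ, v ≠ 0 →
      Multiset.card ((∑ l, C (v ⬝ᵥ ((((-1 : ℝ) ^ d l) • S l) *ᵥ v)) * (X : ℝ[X]) ^ d l).roots.filter
        (fun t => 0 < t)) ≤ 1) :
    (Matrix.det (∑ l, ((X : ℝ[X]) ^ d l) • (S l).map C)).roots.toFinset.card ≤ m + m + 1 := by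
  have h1 := card_posRoots_le_of_oneCrossing_definite hK d hd S hS σ h0 hone
  have h2 := card_posRoots_le_of_oneCrossing_definite hK d hd (fun l => ((-1 : ℝ) ^ d l) • S l)
    (fun l => (hS l).smul _) σ' h0' hone'
  have h3 := stub_negRoots K m d S
  rw [Fintype.card_fin] at h1 h2
  omega

/-! ## §3 The crux's inequality on the sector -/

/-- **The crux inequality on the two-sided one-crossing sector, every fat format.**  For all `c, q` there is `K₀` such that
for `K ≥ K₀`, `m ≤ 2^{(⌊log₂K⌋+c)^c}`, `K ≥ 2`, strictly increasing exponents, real symmetric letters with `F(X)` and `F(−X)`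
both of definite lowest letter and one-crossing Rayleigh `K`-nomials: `Z^q ≤ 2^{K⌊log₂K⌋}`. [folklore] -/
theorem oneCrossing_mdr (c q : ℕ) : ∃ K₀ : ℕ, ∀ K m : ℕ, K₀ ≤ K → m ≤ 2 ^ ((Nat.log 2 K + c) ^ c) →
    ∀ hK : 2 ≤ K, ∀ (d : Fin K → ℕ), StrictMono d → ∀ (S : Fin K → Matrix (Fin m) (Fin m) ℝ), (∀ l, (S l).IsSymm) →
    ∀ σ σ' : ℝ,
    (∀ v : Fin m → ℝ, v ≠ 0 → 0 < σ * (v ⬝ᵥ (S ⟨0, by omega⟩ *ᵥ v))) →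
    (∀ v : Fin m → ℝ, v ≠ 0 →
      Multiset.card ((∑ l, C (v ⬝ᵥ (S l *ᵥ v)) * (X : ℝ[X]) ^ d l).roots.filter (fun t => 0 < t)) ≤ 1) →
    (∀ v : Fin m → ℝ, v ≠ 0 → 0 < σ' * (v ⬝ᵥ ((((-1 : ℝ) ^ d ⟨0, by omega⟩) • S ⟨0, by omega⟩) *ᵥ v))) →
    (∀ v : Fin m → ℝ, v ≠ 0 →
      Multiset.card ((∑ l, C (v ⬝ᵥ ((((-1 : ℝ) ^ d l) • S l) *ᵥ v)) * (X : ℝ[X]) ^ d l).roots.filter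
        (fun t => 0 < t)) ≤ 1) →
    (Matrix.det (∑ l, ((X : ℝ[X]) ^ d l) • (S l).map C)).roots.toFinset.card ^ q ≤ 2 ^ (K * Nat.log 2 K) := by
  obtain ⟨K₀, hK₀⟩ := Census.fatFormat_absorb 1 c q
  refine ⟨K₀, fun K m hK hm hK2 d hd S hS σ σ' h0 hone h0' hone' => hK₀ K m _ hK hm ?_⟩
  have hZ := oneCrossing_realRoots_le K m hK2 d hd S hS σ σ' h0 hone h0' hone'
  have h4 : m + m + 1 ≤ 2 ^ 1 * (m + 1) * (K + 1) := by nlinarith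
  exact hZ.trans h4

end DefiniteMoments

end Summit.ValiantsHypothesis.ValiantsHypothesis.Theorems.LacunarySymmetroidMatrixDescartes
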